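import Summits.HodgeConjecture.HodgeConjecture.Theses.AmpleAdicLefschetz
import Literature.AlgebraicGeometry.HodgeTheory.LefschetzOneOneHolds
import Literature.AlgebraicGeometry.HodgeTheory.HodgeTypePullback
import Literature.AlgebraicGeometry.HodgeTheory.ComplexConjugationHolds
import HarnessLib

/-!
# Route AmpleAdicLefschetz — crux `SectionalSource`: the low-degree calibration `p ≤ 1 ∨ n ≤ 4`

The crux `SectionalSource` (SS) of the route `AmpleAdicLefschetz` asks: for `X` smooth projective of
dimension `n` over `ℂ`, `2p + 1 ≤ n`, and `c` a rational `(p,p)`-class in `H²ᵖ(X(ℂ); ℂ)`, there is an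
ADMISSIBLE PROPER SECTION `(m, Y, f, s)` — `Y` smooth projective of dimension `m`, `f : Y ⟶ X` a closed
immersion, `s` a finite set of affine opens of `X` whose union is exactly `X ∖ f(Y)`, `2p + |s| ≤ n`,
`X ∖ f(Y) ≠ ∅` — with `f^* c ∈ algebraicClasses Y p` [Deligne2000] §1.

This file proves the LOW-DEGREE CALIBRATION of SS: granted the Bertini SUPPLY of affine-complement
hypersurface sections (every smooth projective `X` of dimension `n ≥ 1` contains a smooth projective
closed subscheme `Y` of dimension `n − 1` whose complement is ONE non-empty affine open `U`;
[Hartshorne1977] II Thm. 8.18), SS holds whenever `p ≤ 1 ∨ n ≤ 4`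
(`sectionalSource_lowDegree_of_supply`). Proof: take the supplied `(Y, f, U)` and `s = {U}` (`|s| = 1`,
and `2p + 1 ≤ n` is the hypothesis). The class `f^* c` is rational (`IsRationalClass.map`) and of Hodge
type `(p,p)` on `Y` (`IsOfHodgeType.map_of_le`, [VoisinHodgeI2002] §7.3.2, with a Hodge model of `Y` from
`nonempty_hodgeModel_holds` and `n − 1 ≤ n`). Then: for `p = 0`, `algebraicClasses Y 0 = ⊤`
(`algebraicClasses_zero`); for `p = 1`, Lefschetz's theorem on `(1,1)`-classes on `Y`
(`lefschetzOneOne_rational_holds`, [VoisinHodgeI2002] Thm. 11.30); for `n ≤ 4`, `dim Y = n − 1 ≤ 3` and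
the Hodge conjecture holds on `Y` in every degree (`hodgeClasses_algebraic_of_dim_le_three_holds`,
[VoisinHodgeII2003] proof of Prop. 10.26). The corollary `span_lowDegree_of_supply` packages the same as
"every rational `(p,p)`-class in the low-degree range is sectionally algebraic, hence lies in the span of
the sectionally algebraic rational `(p,p)`-classes" (the SPAN stub of the line, trivially, in that range).
`stub_lowDegree` is the registered stub of the line `registered` of the crux (skeleton
`Cruxes/SectionalSource/Lines/birth.lean`, reshape 2026-08-17): SUPPLY ⇒ SS on `p ≤ 1 ∨ n ≤ 4`.

## References

* P. Deligne, *The Hodge conjecture*, Clay Mathematics Institute (2000), §1. [Deligne2000]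
* C. Voisin, *Hodge Theory and Complex Algebraic Geometry I* (2002), Thm. 11.30, §7.3.2. [VoisinHodgeI2002]
* C. Voisin, *Hodge Theory and Complex Algebraic Geometry II* (2003), proof of Prop. 10.26. [VoisinHodgeII2003]
* R. Hartshorne, *Algebraic Geometry* (1977), II Thm. 8.18. [Hartshorne1977]
-/

noncomputable section

set_option linter.dupNamespace false

open CategoryTheory AlgebraicGeometry
open Literature.AlgebraicGeometry.Motives Literature.AlgebraicGeometry.HodgeTheory
open Summit.HodgeConjecture.HodgeConjecture.Theses.AmpleAdicLefschetz

namespace Summit.HodgeConjecture.HodgeConjecture.Theorems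

/-- **Low-degree calibration of the crux `SectionalSource`.** Granted the Bertini supply of
affine-complement hypersurface sections (`hSup`: every smooth projective `X` of dimension `n ≥ 1` has a
smooth projective closed subscheme `Y` of dimension `n − 1` whose complement is one non-empty affine
open), every rational `(p,p)`-class `c ∈ H²ᵖ(X(ℂ); ℂ)` with `2p + 1 ≤ n` and `p ≤ 1 ∨ n ≤ 4` becomes
algebraic on an admissible proper section: the supplied `Y` with `s = {U}`. Indeed `f^* c` is a rational
`(p,p)`-class on `Y` (pull-backs preserve rationality and Hodge type), and it is algebraic by
`algebraicClasses Y 0 = ⊤` (`p = 0`), by Lefschetz `(1,1)` on `Y` (`p = 1`), or by the Hodge conjecture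
in dimension `dim Y = n − 1 ≤ 3` (`n ≤ 4`). [cite: VoisinHodgeI2002, Thm. 11.30]
[cite: VoisinHodgeII2003, proof of Prop. 10.26] [cite: Deligne2000, §1] [cite: Hartshorne1977, II 8.18] -/
theorem sectionalSource_lowDegree_of_supply
    (hSup : ∀ ⦃n : ℕ⦄ ⦃X : Literature.AlgebraicGeometry.Motives.SchemeOver ℂ⦄,
      Literature.AlgebraicGeometry.Motives.IsSmoothProjective n X → 1 ≤ n →
      ∃ (Y : Literature.AlgebraicGeometry.Motives.SchemeOver ℂ) (f : Y ⟶ X) (U : X.left.Opens),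
        Literature.AlgebraicGeometry.Motives.IsSmoothProjective (n - 1) Y ∧
          AlgebraicGeometry.IsClosedImmersion f.left ∧ AlgebraicGeometry.IsAffineOpen U ∧
          (U : Set X.left) = (Set.range f.left.base)ᶜ ∧ Set.Nonempty (Set.range f.left.base)ᶜ)
    ⦃n p : ℕ⦄ ⦃X : SchemeOver ℂ⦄ (hX : IsSmoothProjective n X) (hp : 2 * p + 1 ≤ n)
    (hlow : p ≤ 1 ∨ n ≤ 4) (c : complexBetti X (2 * p)) (hc : IsRationalClass c)
    (hh : IsOfHodgeType n X (2 * p) p p c) :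
    ∃ (m : ℕ) (Y : SchemeOver ℂ) (f : Y ⟶ X) (s : Finset X.left.Opens),
      IsSmoothProjective m Y ∧ IsClosedImmersion f.left ∧ (∀ U ∈ s, IsAffineOpen U) ∧
        (⋃ U ∈ s, (U : Set X.left)) = (Set.range f.left.base)ᶜ ∧ 2 * p + s.card ≤ n ∧
        Set.Nonempty (Set.range f.left.base)ᶜ ∧ complexBetti.map f (2 * p) c ∈ algebraicClasses Y p := by
  obtain ⟨Y, f, U, hY, hf, hU, hUc, hne⟩ := hSup hX (by omega)
  refine ⟨n - 1, Y, f, {U}, hY, hf, ?_, ?_, ?_, hne, ?_⟩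
  · intro V hV
    rw [Finset.mem_singleton] at hV
    subst hV
    exact hU
  · rw [← hUc]
    simp only [Finset.mem_singleton, Set.iUnion_iUnion_eq_left]
  · rw [Finset.card_singleton]
    exact hp
  · obtain ⟨B⟩ := (nonempty_hodgeModel_holds (n := n - 1) (X := Y)) hY
    have hrat : IsRationalClass (complexBetti.map f (2 * p) c) :=
      hc.map (AlgPoints.mapContinuous (L := ℂ) f)
    have hhdg : IsOfHodgeType (n - 1) Y (2 * p) p p (complexBetti.map f (2 * p) c) :=
      hh.map_of_le hY hX B f (by omega)
    rcases hlow with hp1 | hn4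
    · interval_cases p
      · rw [algebraicClasses_zero]
        trivial
      · exact lefschetzOneOne_rational_holds hY _ hrat hhdg
    · exact hodgeClasses_algebraic_of_dim_le_three_holds (by omega) hY p _ hrat hhdg

/-- **The SPAN stub in the low-degree range, trivially.** Granted the Bertini supply `hSup`, every
rational `(p,p)`-class `c ∈ H²ᵖ(X(ℂ); ℂ)` with `2p + 1 ≤ n` and `p ≤ 1 ∨ n ≤ 4` is itself sectionally
algebraic (`sectionalSource_lowDegree_of_supply`), hence lies in the `ℂ`-span of the sectionally
algebraic rational `(p,p)`-classes (`Submodule.subset_span`). [cite: VoisinHodgeI2002, Thm. 11.30]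
[cite: VoisinHodgeII2003, proof of Prop. 10.26] [cite: Deligne2000, §1] -/
theorem span_lowDegree_of_supply
    (hSup : ∀ ⦃n : ℕ⦄ ⦃X : Literature.AlgebraicGeometry.Motives.SchemeOver ℂ⦄,
      Literature.AlgebraicGeometry.Motives.IsSmoothProjective n X → 1 ≤ n →
      ∃ (Y : Literature.AlgebraicGeometry.Motives.SchemeOver ℂ) (f : Y ⟶ X) (U : X.left.Opens),
        Literature.AlgebraicGeometry.Motives.IsSmoothProjective (n - 1) Y ∧
          AlgebraicGeometry.IsClosedImmersion f.left ∧ AlgebraicGeometry.IsAffineOpen U ∧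
          (U : Set X.left) = (Set.range f.left.base)ᶜ ∧ Set.Nonempty (Set.range f.left.base)ᶜ)
    ⦃n p : ℕ⦄ ⦃X : SchemeOver ℂ⦄ (hX : IsSmoothProjective n X) (hp : 2 * p + 1 ≤ n)
    (hlow : p ≤ 1 ∨ n ≤ 4) (c : complexBetti X (2 * p)) (hc : IsRationalClass c)
    (hh : IsOfHodgeType n X (2 * p) p p c) :
    c ∈ Submodule.span ℂ {g : complexBetti X (2 * p) |
      IsRationalClass g ∧ IsOfHodgeType n X (2 * p) p p g ∧
        ∃ (m : ℕ) (Y : SchemeOver ℂ) (f : Y ⟶ X) (s : Finset X.left.Opens),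
          IsSmoothProjective m Y ∧ IsClosedImmersion f.left ∧ (∀ U ∈ s, IsAffineOpen U) ∧
            (⋃ U ∈ s, (U : Set X.left)) = (Set.range f.left.base)ᶜ ∧ 2 * p + s.card ≤ n ∧
            Set.Nonempty (Set.range f.left.base)ᶜ ∧
            complexBetti.map f (2 * p) g ∈ algebraicClasses Y p} :=
  Submodule.subset_span ⟨hc, hh, sectionalSource_lowDegree_of_supply hSup hX hp hlow c hc hh⟩

/-- **The registered stub `stub_lowDegree` of the line `registered` (crux `SectionalSource`,
stmt-HodgeConjecture-10725), by name and signature**: SUPPLY ⇒ the crux on the range `p ≤ 1 ∨ n ≤ 4`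
(`sectionalSource_lowDegree_of_supply` with the supply hypothesis as antecedent). The first slice of the
crux not covered is `(n, p) = (5, 2)`. [cite: VoisinHodgeI2002, Thm. 11.30]
[cite: VoisinHodgeII2003, proof of Prop. 10.26] [cite: Deligne2000, §1] -/
theorem stub_lowDegree :
    (∀ ⦃n : ℕ⦄ ⦃X : Literature.AlgebraicGeometry.Motives.SchemeOver ℂ⦄,
        Literature.AlgebraicGeometry.Motives.IsSmoothProjective n X → 1 ≤ n →
        ∃ (Y : Literature.AlgebraicGeometry.Motives.SchemeOver ℂ) (f : Y ⟶ X) (U : X.left.Opens),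
          Literature.AlgebraicGeometry.Motives.IsSmoothProjective (n - 1) Y ∧
            AlgebraicGeometry.IsClosedImmersion f.left ∧ AlgebraicGeometry.IsAffineOpen U ∧
            (U : Set X.left) = (Set.range f.left.base)ᶜ ∧ Set.Nonempty (Set.range f.left.base)ᶜ) →
    ∀ ⦃n p : ℕ⦄ ⦃X : Literature.AlgebraicGeometry.Motives.SchemeOver ℂ⦄,
      Literature.AlgebraicGeometry.Motives.IsSmoothProjective n X → 2 * p + 1 ≤ n → (p ≤ 1 ∨ n ≤ 4) →
      ∀ c : Literature.AlgebraicGeometry.HodgeTheory.complexBetti X (2 * p),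
        Literature.AlgebraicGeometry.HodgeTheory.IsRationalClass c →
        Literature.AlgebraicGeometry.HodgeTheory.IsOfHodgeType n X (2 * p) p p c →
        ∃ (m : ℕ) (Y : Literature.AlgebraicGeometry.Motives.SchemeOver ℂ) (f : Y ⟶ X)
          (s : Finset X.left.Opens),
          Literature.AlgebraicGeometry.Motives.IsSmoothProjective m Y ∧
            AlgebraicGeometry.IsClosedImmersion f.left ∧ (∀ U ∈ s, AlgebraicGeometry.IsAffineOpen U) ∧
            (⋃ U ∈ s, (U : Set X.left)) = (Set.range f.left.base)ᶜ ∧ 2 * p + s.card ≤ n ∧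
            Set.Nonempty (Set.range f.left.base)ᶜ ∧
            Literature.AlgebraicGeometry.HodgeTheory.complexBetti.map f (2 * p) c ∈
              Literature.AlgebraicGeometry.HodgeTheory.algebraicClasses Y p :=
  fun hSup _ _ _ hX hp hlow c hc hh => sectionalSource_lowDegree_of_supply hSup hX hp hlow c hc hh

end Summit.HodgeConjecture.HodgeConjecture.Theorems

end
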